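import Literature.MathematicalPhysics.QuantumFieldTheory.Balaban1983to89.B15Prop1LinearisedDatumCoordinates

/-!
# `Balaban1983to89.B15Prop1OntoFromRightInverse` — [Balaban1985Variational] = «[15]», Sect. C (45) p. 285 («L^jηQ_jHB = B»), (47)–(48), (82)–(83) p. 290; [Balaban1988Convergent] (2.10)–(2.11) p. 256:
# THE LETTER `honto` FROM A REAL RIGHT INVERSE OF THE LINEARISED MULTI-SCALE AVERAGING IN VELOCITY CURRENCY — «DΦ₀(0) onto» for the complex slice coordinates of
# `B15Prop1LocalChartAtBaseField` from n07-w2's `hH`-type letter (left chart)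

Honest framing: statement-level skeleton of published theorems with citation tags; proofs where landed; nothing here is a claim about the
Yang–Mills mass gap.  Cell `pub-ymgap`, HUMAN RULING D-0149 (width seats), seat `pub-ymgap-dag-n12-w1` (g2; N12 = [B15]; U1a⁺ of the w1 lineage);
count-neutral; N12 NOT discharged; finite 𝕋⁴ at fixed ε; nothing continuum ∕ OS ∕ mass-gap ∕ Clay.

WHAT.  At a base configuration `U₀` on the fibre of `W` (guarded below `k`), with the constraint coordinates `Φ₀ X = κ (expMulC X ↑U₀)` restricted to a slice `S`: IF for every family of
real coefficient vectors `τ_i ∈ ℝ³` (i.e. every `𝔰𝔲(2)`-valued target `Σ_a τ_{i,a} E_a` at the constrained bonds) there is a REAL direction `p` in the slice whose relative-average VELOCITIES are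
`W_j(c) · Σ_a τ_{i,a} E_a` ([15] (45): a right inverse `H` of the linearised averaging), THEN `DΦ₀(0) : S → (Fin n → ℂ³)` is ONTO (`honto`): the velocity formula of
`B15Prop1LinearisedDatumCoordinates` gives `DΦ₀(0)(cplxVec p)_i = T(τ_i) = τ_i` (`tr(E_a E_b) = −2δ_{ab}`), i.e. every REAL target is hit from the slice, and dag-n12-w2's `LagrangeHessianRealCoercive.surjective_of_real_surjective`
finishes.

CONTENTS (theorems only; no `def`, no `instance`, no `sorry`).  `logCoordCLM_genE_sum` (`T (Σ_a y_a E_a) = y`), ★★ `honto_of_rightInverse`.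
-/

noncomputable section

namespace Literature.MathematicalPhysics.QuantumFieldTheory.Balaban1983to89.B15Prop1OntoFromRightInverse

open Set Filter
open scoped Topology ContDiff ComplexConjugate
open Literature.Analysis.Calculus.LagrangeHessianRealCoercive (surjective_of_real_surjective)
open Literature.MathematicalPhysics.QuantumFieldTheory.Balaban1983to89.Node00 (SU coeField coeField_apply SmallBelow ConstrSet constrCard constrEnum star_coe_mul_coe_SU)
open B15AveragingHolomorphic (iterMh)
open B15SU2ChartHolomorphic (genE expMulC logCoordC trace_genE_mul_genE)
open B15Prop1StateChartSU2 (exists_conjCLM_pi analyticAt_expMulC_right)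
open B15Prop1DatumCoordinates (eventually_analyticAt_datumCoord expMulC_zero_left)
open B15Prop1LinearisedDatumCoordinates (exists_logCoordCLM fderiv_datumCoord_expMulC_apply_of_hasDerivAt)
open B15Prop1AnalyticExtClause (cplxVec)
open B15Prop1ChartCalculusSU2 (E3)
open B15Prop1ChartSU2 (su2Chart)
open B16Sect1Backgrounds (expMul)
open ExpMeanLog (expMeanLogSU)
open BlockAveraging (blockAvg)
open T4CubeChartGnomonic (SU2)
open T4Continuum B15DeterminingSets GaugeField
open scoped Matrix.Norms.L2Operator

/-- `T (Σ_a y_a E_a) = y` for the linear part `T` of the logarithmic coordinates (`tr(E_a E_b) = −2δ_{ab}`). [cite: Balaban1989LargeFieldII, (1.19) p.360; Balaban1985Averaging, (21) p.21 (bookkeeping)] -/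
theorem logCoordCLM_genE_sum {T : Matrix (Fin 2) (Fin 2) ℂ →L[ℂ] EuclideanSpace ℂ (Fin 3)} (hT : ∀ M a, T M a = -(1 / 2 : ℂ) * (genE a * M).trace)
    (y : EuclideanSpace ℂ (Fin 3)) : T (∑ b : Fin 3, y b • genE b) = y := by
  ext a
  rw [hT, Finset.mul_sum, Matrix.trace_sum]
  simp only [Matrix.mul_smul, Matrix.trace_smul, trace_genE_mul_genE, smul_eq_mul, mul_ite, mul_neg, mul_zero, Finset.sum_ite_eq, Finset.mem_univ, if_true]
  ring

variable {P : Params}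

/-- ★★ **`honto` FROM A REAL RIGHT INVERSE OF THE LINEARISED AVERAGING (velocity currency).**  Base configuration `U₀` on the fibre of `W`, guarded below `k`; constraint coordinates
`Φ₀ X = κ (expMulC X ↑U₀)` (`κ` pointwise as in `B15Prop1DatumCoordinates`); a slice `S`.  Hypothesis `hH` ([15] (45)): for every family `τ : Fin n → ℝ³` there is a real bond field `p` with
`cplxVec p ∈ S` such that for every constrained bond `(j,c)` the relative average `s ↦ ↑Ū^j(exp(s p)·U₀)(c)` has velocity `↑W_j(c) · Σ_a τ_{i,a} E_a` at `0`.  Conclusion: the derivative at `0`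
of `Φ₀` restricted to `S` is surjective. [cite: Balaban1985Variational, Sect. C (45),(47)–(48) p.285, (82)–(83) p.290; Balaban1988Convergent, (2.10)–(2.11) p.256] -/
theorem honto_of_rightInverse (𝔹 : DetSet P) (k : ℕ) (W : MSField P SU2)
    (κ : (PBond P 0 → Matrix (Fin 2) (Fin 2) ℂ) → Fin (constrCard 𝔹 k) → EuclideanSpace ℂ (Fin 3))
    (hκ : ∀ Q i, κ Q i = logCoordC (star ((W ((constrEnum 𝔹 k).symm i).1 ((constrEnum 𝔹 k).symm i).2.1 : SU2) : Matrix (Fin 2) (Fin 2) ℂ) *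
      iterMh ((constrEnum 𝔹 k).symm i).1 Q ((constrEnum 𝔹 k).symm i).2.1))
    {U₀ : GaugeField P 0 SU2} (hsb : SmallBelow (fun j => blockAvg (P := P) (j := j) expMeanLogSU) k U₀)
    (hU : AgreeOn 𝔹 (avgFamily (fun j => blockAvg (P := P) (j := j) expMeanLogSU) U₀) W)
    (S : Submodule ℂ (VecField P 0 (EuclideanSpace ℂ (Fin 3))))
    (Φ₀ : S → Fin (constrCard 𝔹 k) → EuclideanSpace ℂ (Fin 3)) (hΦ₀ : ∀ X : S, Φ₀ X = κ (expMulC (X : VecField P 0 (EuclideanSpace ℂ (Fin 3))) (coeField U₀)))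
    (hH : ∀ τ : Fin (constrCard 𝔹 k) → EuclideanSpace ℝ (Fin 3), ∃ p : VecField P 0 E3, cplxVec p ∈ S ∧
      ∀ i : Fin (constrCard 𝔹 k), HasDerivAt (fun s : ℝ => ((avgFamily (fun j => blockAvg (P := P) (j := j) expMeanLogSU) (expMul su2Chart (s • p) U₀)
        ((constrEnum 𝔹 k).symm i).1 ((constrEnum 𝔹 k).symm i).2.1 : SU2) : Matrix (Fin 2) (Fin 2) ℂ))
        (((W ((constrEnum 𝔹 k).symm i).1 ((constrEnum 𝔹 k).symm i).2.1 : SU2) : Matrix (Fin 2) (Fin 2) ℂ) * ∑ b : Fin 3, ((τ i b : ℝ) : ℂ) • genE b) 0) :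
    Function.Surjective (fderiv ℂ Φ₀ 0) := by
  obtain ⟨cF, hcF, hcFinv⟩ := exists_conjCLM_pi (Fin (constrCard 𝔹 k))
  obtain ⟨T, hT⟩ := exists_logCoordCLM
  -- `Φ₀ = Ψ ∘ val` with `Ψ X = κ (expMulC X ↑U₀)` analytic at `0`; its derivative on `S` is the restriction of `DΨ(0)`
  have hΨan : AnalyticAt ℂ (fun X : VecField P 0 (EuclideanSpace ℂ (Fin 3)) => κ (expMulC X (coeField U₀))) 0 := by
    have h1 : AnalyticAt ℂ κ (expMulC (0 : VecField P 0 (EuclideanSpace ℂ (Fin 3))) (coeField U₀)) := by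
      rw [expMulC_zero_left]; exact (eventually_analyticAt_datumCoord 𝔹 k W κ hκ hsb hU).self_of_nhds
    exact AnalyticAt.comp (f := fun X : VecField P 0 (EuclideanSpace ℂ (Fin 3)) => expMulC X (coeField U₀)) (x := 0) h1
      (analyticAt_expMulC_right (coeField U₀) 0)
  have hfun : Φ₀ = (fun X : VecField P 0 (EuclideanSpace ℂ (Fin 3)) => κ (expMulC X (coeField U₀))) ∘ (S.subtypeL : S →L[ℂ] VecField P 0 (EuclideanSpace ℂ (Fin 3))) :=
    funext fun X => hΦ₀ X
  have hD : fderiv ℂ Φ₀ 0 = (fderiv ℂ (fun X : VecField P 0 (EuclideanSpace ℂ (Fin 3)) => κ (expMulC X (coeField U₀))) 0).comp S.subtypeL := by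
    rw [hfun, fderiv_comp (0 : S) (by rw [map_zero]; exact hΨan.differentiableAt) S.subtypeL.differentiableAt, S.subtypeL.fderiv, map_zero]
  -- real targets are hit from the slice
  refine surjective_of_real_surjective cF hcFinv (fderiv ℂ Φ₀ 0) fun y hy => ?_
  -- the real coefficients of the real target `y`
  let τ : Fin (constrCard 𝔹 k) → EuclideanSpace ℝ (Fin 3) := fun i => WithLp.toLp 2 fun b => (y i b).re
  have hyτ : ∀ i, (∑ b : Fin 3, ((τ i b : ℝ) : ℂ) • genE b) = ∑ b : Fin 3, y i b • genE b := by
    intro i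
    refine Finset.sum_congr rfl fun b _ => ?_
    have hb : ((τ i b : ℝ) : ℂ) = y i b := by
      have hfix := congrArg (fun v : Fin (constrCard 𝔹 k) → EuclideanSpace ℂ (Fin 3) => v i b) hy
      simp only at hfix; rw [hcF] at hfix
      apply Complex.ext
      · simp [τ]
      · have h2 := congrArg Complex.im hfix
        rw [Complex.conj_im] at h2
        simp [τ]; linarith
    rw [hb]
  obtain ⟨p, hpS, hv⟩ := hH τ
  refine ⟨⟨cplxVec p, hpS⟩, ?_⟩
  funext i
  rw [hD, ContinuousLinearMap.coe_comp, Function.comp_apply, Submodule.subtypeL_apply,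
    fderiv_datumCoord_expMulC_apply_of_hasDerivAt 𝔹 k W κ hκ hsb hU hT p i (hv i), ← mul_assoc, star_coe_mul_coe_SU, one_mul, hyτ,
    logCoordCLM_genE_sum hT]

end Literature.MathematicalPhysics.QuantumFieldTheory.Balaban1983to89.B15Prop1OntoFromRightInverse

end
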